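import Mathlib
import HarnessLib
import Summits.HubbardSuperconductivity.HubbardSuperconductivity.Theorems.ChiralWindowCwKLChiralWindowChannelBoundR
import Summits.HubbardSuperconductivity.HubbardSuperconductivity.Theorems.ChiralWindowCwKLChiralWindowNodeBound
import Summits.HubbardSuperconductivity.HubbardSuperconductivity.Theorems.ChiralWindowCwKLChiralWindowD4Invariant
import Summits.HubbardSuperconductivity.HubbardSuperconductivity.Theorems.CwKLChiralWindow.Negative.ChannelStructure
import Summits.HubbardSuperconductivity.HubbardSuperconductivity.Theorems.ChiralWindowCwChannelInfContinuousL2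
import Literature.Analysis.OperatorTheory.CompactSelfAdjointBottom
import Literature.Analysis.OperatorTheory.CompactSelfAdjointEigenbasis
import Literature.Analysis.OperatorTheory.L2KernelIntegralOperator
import Literature.Analysis.OperatorTheory.EigenvectorSpan
import Literature.MathematicalPhysics.QuantumLattice.KohnLuttingerChannelStates

/-!
# Crux `CwKLChiralWindow` (stmt-1741), line `Sketch`: pointwise amplitude bounds for bottom states, RESIDUAL form

`stub_klNodeBoundR`: the residual-form variant of `stub_klNodeBound` (`…NodeBound`).  In the setting of `…ChannelBoundR`
(channel `χ`, base kernel `κ`, trial `Φ`, certified enclosures with the RESIDUAL bound `∫ (∫ κ Φ - s Φ)² ≤ et ∫ Φ²` in place of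
the image-norm bound), in the equality case `withU ∨ χ ≠ A1g`, with a row bound `∫ κ(k,·)² ≤ R2` a.e. and the multiplicity
condition `h < 2ρhi²` (`3ρhi²` on `E`), every bottom state `ψ` obeys a.e. `|F_Φ(k)| ≤ √N (|L| |ψ(k)| + √R2 √e)` off `E`,
`|F_Φ(k)|, |F_Φ(rot³k)| ≤ √N (|L| √(ψ(k)²+ψ(rot k)²) + √R2 √e)` on `E` (`F_Φ = ∫ κ Φ`, `L = min g(ρlo) g(ρhi)` the residual Temple
bound, `g(ρ) = (βρ - ρ² - et)/(β - ρ)`, and `e = et/(β - ρhi)²` Kato's residual bound).  The proof is that of `…NodeBound` on top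
of `kl_cbr_setup`; the `α`-free helpers `kl_nb_bottom_eigvec`, `kl_nb_remainder_ae`, `kl_nb_cs_two` of `…NodeBound` are reused. -/

noncomputable section

set_option linter.dupNamespace false

namespace Summit.HubbardSuperconductivity.HubbardSuperconductivity.Theorems

open MeasureTheory Literature.MathematicalPhysics.QuantumLattice Literature.Analysis.OperatorTheory

/-! ### Node covering, residual form -/

set_option maxHeartbeats 1600000 in
/-- **Pointwise amplitude bounds for bottom states, residual form** (`stub_klNodeBoundR`). In the setting of
`stub_klChannelBoundR` (equality case `withU ∨ χ ≠ A1g`, residual bound `∫ (∫ κ Φ - s Φ)² ≤ et ∫ Φ²`), with a row bound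
`∫ κ(k,·)² ≤ R2` a.e. and the multiplicity condition `h < 2ρhi²` (`h < 3ρhi²` for `E`): every channel state `ψ` attaining the
bottom controls the trial amplitude `F_Φ(k) = ∫ κ(k,k') Φ(k') dσ` pointwise a.e., `|F_Φ(k)| ≤ √N (|L| |ψ(k)| + √R2 √e)` off `E` and
`|F_Φ(k)|, |F_Φ(rot³k)| ≤ √N (|L| √(ψ(k)² + ψ(rot k)²) + √R2 √e)` on `E`, where `L = min g(ρlo) g(ρhi)`,
`g(ρ) = (βρ - ρ² - et)/(β - ρ)`, is the residual Temple bound and `e = et/(β - ρhi)²` Kato's residual distance bound (bottom states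
are eigenvectors; the bottom eigenspace is the line through `[ψ]`, resp. the plane through `[ψ], [ψ∘rot]`; the normalised trial is
within `√e` of it; the remainder is controlled row-wise by Cauchy–Schwarz). [folklore] -/
theorem stub_klNodeBoundR : ∀ μ ∈ Set.Ioo (-4 : ℝ) 0, ∀ (χ : D4Irrep) (withU : Bool) (M : ℕ) (c : Fin M → ℝ)
    (u : Fin M → Momentum → ℝ) (Φ : Momentum → ℝ) (ρlo ρhi et h β s R2 : ℝ),
    (withU = true → χ = D4Irrep.A1g) → (∀ m, 0 ≤ c m) →
    (∀ m, MemLp (u m) 2 (fermiCurveMeasure (squareDispersion 1 0) μ)) →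
    MemLp Φ 2 (fermiCurveMeasure (squareDispersion 1 0) μ) → InChannel χ Φ →
    0 < ∫ k, Φ k ^ 2 ∂fermiCurveMeasure (squareDispersion 1 0) μ →
    ρlo * ∫ k, Φ k ^ 2 ∂fermiCurveMeasure (squareDispersion 1 0) μ ≤
      ∫ k, Φ k * ∫ k', ((if withU then 1 else 0) + lindhardFunction (squareDispersion 1 0) μ (k + k')) * Φ k'
        ∂fermiCurveMeasure (squareDispersion 1 0) μ ∂fermiCurveMeasure (squareDispersion 1 0) μ →
    ∫ k, Φ k * ∫ k', ((if withU then 1 else 0) + lindhardFunction (squareDispersion 1 0) μ (k + k')) * Φ k'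
        ∂fermiCurveMeasure (squareDispersion 1 0) μ ∂fermiCurveMeasure (squareDispersion 1 0) μ ≤
      ρhi * ∫ k, Φ k ^ 2 ∂fermiCurveMeasure (squareDispersion 1 0) μ →
    ρhi < 0 →
    ∫ k, (∫ k', ((if withU then 1 else 0) + lindhardFunction (squareDispersion 1 0) μ (k + k')) * Φ k'
        ∂fermiCurveMeasure (squareDispersion 1 0) μ - s * Φ k) ^ 2 ∂fermiCurveMeasure (squareDispersion 1 0) μ ≤
      et * ∫ k, Φ k ^ 2 ∂fermiCurveMeasure (squareDispersion 1 0) μ →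
    ∫ z, (d4Project χ (fun q => (if withU then 1 else 0) + lindhardFunction (squareDispersion 1 0) μ (z.1 + q)) z.2 -
        ∑ m, c m * (u m z.1 * u m z.2)) ^ 2
        ∂(fermiCurveMeasure (squareDispersion 1 0) μ).prod (fermiCurveMeasure (squareDispersion 1 0) μ) ≤ h →
    β ≤ 0 → h - (if χ = D4Irrep.E then 2 else 1) * ρhi ^ 2 ≤ β ^ 2 → ρhi < β →
    (withU = true ∨ χ ≠ D4Irrep.A1g) → 0 ≤ R2 →
    (∀ᵐ k ∂fermiCurveMeasure (squareDispersion 1 0) μ, ∫ k', ((if withU then 1 else 0) + lindhardFunction (squareDispersion 1 0) μ (k + k')) ^ 2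
        ∂fermiCurveMeasure (squareDispersion 1 0) μ ≤ R2) →
    h < (if χ = D4Irrep.E then 3 else 2) * ρhi ^ 2 →
    ∀ ψ : Momentum → ℝ, IsChannelState (squareDispersion 1 0) μ χ ψ →
      pairingForm (squareDispersion 1 0) μ 1 ψ = channelInf (squareDispersion 1 0) μ 1 χ →
      (χ ≠ D4Irrep.E → ∀ᵐ k ∂fermiCurveMeasure (squareDispersion 1 0) μ,
        |∫ k', ((if withU then 1 else 0) + lindhardFunction (squareDispersion 1 0) μ (k + k')) * Φ k'
            ∂fermiCurveMeasure (squareDispersion 1 0) μ| ≤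
          Real.sqrt (∫ k, Φ k ^ 2 ∂fermiCurveMeasure (squareDispersion 1 0) μ) *
            (|min ((β * ρlo - ρlo ^ 2 - et) / (β - ρlo)) ((β * ρhi - ρhi ^ 2 - et) / (β - ρhi))| * |ψ k| +
              Real.sqrt R2 * Real.sqrt (et / (β - ρhi) ^ 2))) ∧
      (χ = D4Irrep.E → ∀ᵐ k ∂fermiCurveMeasure (squareDispersion 1 0) μ,
        |∫ k', ((if withU then 1 else 0) + lindhardFunction (squareDispersion 1 0) μ (k + k')) * Φ k'
            ∂fermiCurveMeasure (squareDispersion 1 0) μ| ≤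
          Real.sqrt (∫ k, Φ k ^ 2 ∂fermiCurveMeasure (squareDispersion 1 0) μ) *
            (|min ((β * ρlo - ρlo ^ 2 - et) / (β - ρlo)) ((β * ρhi - ρhi ^ 2 - et) / (β - ρhi))| * Real.sqrt (ψ k ^ 2 + ψ (rotMomentum k) ^ 2) +
              Real.sqrt R2 * Real.sqrt (et / (β - ρhi) ^ 2)) ∧
        |∫ k', ((if withU then 1 else 0) + lindhardFunction (squareDispersion 1 0) μ
              (rotMomentum (rotMomentum (rotMomentum k)) + k')) * Φ k' ∂fermiCurveMeasure (squareDispersion 1 0) μ| ≤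
          Real.sqrt (∫ k, Φ k ^ 2 ∂fermiCurveMeasure (squareDispersion 1 0) μ) *
            (|min ((β * ρlo - ρlo ^ 2 - et) / (β - ρlo)) ((β * ρhi - ρhi ^ 2 - et) / (β - ρhi))| * Real.sqrt (ψ k ^ 2 + ψ (rotMomentum k) ^ 2) +
              Real.sqrt R2 * Real.sqrt (et / (β - ρhi) ^ 2))) := by
  intro μ hμ χ withU M c u Φ ρlo ρhi et h β s R2 hU hc hu hΦ hΦch hN hρlo hρhi hρhi0 hres hH hβ0 hβ hρβ hcase hR2 hR hmul ψ hψs hbot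
  haveI : IsFiniteMeasure (fermiCurveMeasure (squareDispersion 1 0) μ) :=
    stub_klFiniteMeasure stub_klGradient stub_klHausdorffFinite μ hμ
  obtain ⟨A, P, U₁, V, T, x, l, hmemV, hVc, hA, hAinner, hAsa, hAc, hAP, hPfix, hPrepr, hU₁ae, hAU, hPU, hUinner, hEskew, hT,
    hxnorm, hxdef, hl, hlρ, hLl, hray, -, hkato, hmass⟩ :=
    kl_cbr_setup hμ χ withU hU hu hc hΦ hΦch hN hρlo hρhi hρhi0 hres hH hβ0 hβ hρβ
  haveI : CompleteSpace V := hVc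
  have hκ2 := kl_co_baseKernel_memLp hμ (if withU then 1 else 0)
  -- the bottom state as an eigenvector, and `channelInf = l`
  obtain ⟨-, heig⟩ := kl_nb_bottom_eigvec hμ hU hcase hmemV hAinner hAsa hAc hAP hPfix hPrepr hT hl hlρ hρhi0 hray
  obtain ⟨hwfix, hwnorm, hAw⟩ := heig ψ hψs hbot hψs.1
  have hwae : (hψs.1.toLp ψ : Momentum → ℝ) =ᵐ[fermiCurveMeasure (squareDispersion 1 0) μ] ψ := hψs.1.coeFn_toLp
  obtain ⟨wV, hwV⟩ : ∃ wV : V, (wV : Lp ℝ 2 (fermiCurveMeasure (squareDispersion 1 0) μ)) = hψs.1.toLp ψ :=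
    ⟨⟨_, (hmemV _).2 hwfix⟩, rfl⟩
  have hTwV : T wV = l • wV := Subtype.ext (by rw [hT, Submodule.coe_smul, hwV]; exact hAw)
  have hwVnorm : ‖wV‖ = 1 := by rw [Submodule.coe_norm, hwV, hwnorm]
  -- `|l| ≤ |L|`
  have hl0 : l < 0 := lt_of_le_of_lt hlρ hρhi0
  have hlL : |l| ≤ |min ((β * ρlo - ρlo ^ 2 - et) / (β - ρlo)) ((β * ρhi - ρhi ^ 2 - et) / (β - ρhi))| := by
    rw [abs_of_neg hl0, abs_of_neg (lt_of_le_of_lt hLl hl0)]; linarith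
  -- Kato, upgraded to the orthogonal projection onto the eigenspace `K`
  haveI : CompleteSpace (Module.End.eigenspace (T : Module.End ℝ V) l) := (isClosed_eigenspace T l).completeSpace_coe
  have hmemK : ∀ v : V, v ∈ Module.End.eigenspace (T : Module.End ℝ V) l ↔ T v = l • v := fun v => by
    rw [Module.End.mem_eigenspace_iff]; rfl
  obtain ⟨v₀, hTv₀, hdist₀⟩ := hkato
  obtain ⟨v, hv⟩ : ∃ v : V, v = (Module.End.eigenspace (T : Module.End ℝ V) l).starProjection x := ⟨_, rfl⟩
  obtain ⟨hvclose, hvle, -⟩ := norm_sub_starProjection_le_of_mem (𝕜 := ℝ) (Module.End.eigenspace (T : Module.End ℝ V) l) x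
    ((hmemK v₀).2 hTv₀)
  rw [← hv] at hvclose hvle
  have hTv : T v = l • v := (hmemK v).1 (hv ▸ (Module.End.eigenspace (T : Module.End ℝ V) l).starProjection_apply_mem x)
  have hvnorm : ‖v‖ ≤ 1 := hvle.trans hxnorm.le
  have hηnorm : ‖x - v‖ ≤ Real.sqrt (et / (β - ρhi) ^ 2) := by
    rw [← Real.sqrt_sq (norm_nonneg (x - v))]
    exact Real.sqrt_le_sqrt ((pow_le_pow_left₀ (norm_nonneg _) hvclose 2).trans hdist₀)
  -- a.e. identity for `A x`
  have hsqrtN : 0 < Real.sqrt (∫ k, Φ k ^ 2 ∂fermiCurveMeasure (squareDispersion 1 0) μ) := Real.sqrt_pos.2 hN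
  have hAx : (A (x : Lp ℝ 2 (fermiCurveMeasure (squareDispersion 1 0) μ)) : Momentum → ℝ)
      =ᵐ[fermiCurveMeasure (squareDispersion 1 0) μ] fun k =>
        (Real.sqrt (∫ k, Φ k ^ 2 ∂fermiCurveMeasure (squareDispersion 1 0) μ))⁻¹ *
          ∫ k', ((if withU then 1 else 0) + lindhardFunction (squareDispersion 1 0) μ (k + k')) * Φ k'
            ∂fermiCurveMeasure (squareDispersion 1 0) μ := by
    rw [hxdef, map_smul]
    filter_upwards [Lp.coeFn_smul (Real.sqrt (∫ k, Φ k ^ 2 ∂fermiCurveMeasure (squareDispersion 1 0) μ))⁻¹ (A (hΦ.toLp Φ)), hA (hΦ.toLp Φ)] with k hk hk'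
    rw [hk, Pi.smul_apply, hk', smul_eq_mul,
      kl_bs_kernelIntegral_congr (fun q => (if withU then 1 else 0) + lindhardFunction (squareDispersion 1 0) μ q) hΦ.coeFn_toLp k]
  -- the two cases
  refine ⟨fun hE => ?_, fun hE => ?_⟩
  · -- `χ ≠ E`: the eigenspace is the line through `wV`
    have hno : ∀ f : Fin 2 → V, Orthonormal ℝ f → (∀ j, T (f j) = l • f j) → False := by
      intro f hf heigf
      have h1 := hmass 2 f hf heigf
      have h2 : h < 2 * ρhi ^ 2 := by simpa [hE] using hmul
      push_cast at h1
      linarith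
    have hvspan : v = (inner ℝ wV v) • wV := eq_smul_of_no_orthonormal_pair T l hwVnorm hTwV hno hTv
    have ha : |inner ℝ wV v| ≤ 1 := by
      have := abs_real_inner_le_norm wV v
      rw [hwVnorm, one_mul] at this
      exact this.trans hvnorm
    -- the remainder `η = x - a w`
    obtain ⟨η, hη⟩ : ∃ η : Lp ℝ 2 (fermiCurveMeasure (squareDispersion 1 0) μ),
        η = (x : Lp ℝ 2 (fermiCurveMeasure (squareDispersion 1 0) μ)) - (inner ℝ wV v) • hψs.1.toLp ψ := ⟨_, rfl⟩
    have hvH : (v : Lp ℝ 2 (fermiCurveMeasure (squareDispersion 1 0) μ)) = (inner ℝ wV v) • hψs.1.toLp ψ := by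
      conv_lhs => rw [hvspan]
      rw [Submodule.coe_smul, hwV]
    have hηeq : η = ((x - v : V) : Lp ℝ 2 (fermiCurveMeasure (squareDispersion 1 0) μ)) := by
      rw [hη, Submodule.coe_sub, hvH]
    have hηnorm' : ‖η‖ ≤ Real.sqrt (et / (β - ρhi) ^ 2) := by rw [hηeq, Submodule.norm_coe]; exact hηnorm
    have hrem := kl_nb_remainder_ae hμ _ hκ2 hA hR η
    have hAη : (A η : Momentum → ℝ) =ᵐ[fermiCurveMeasure (squareDispersion 1 0) μ] fun k =>
        (Real.sqrt (∫ k, Φ k ^ 2 ∂fermiCurveMeasure (squareDispersion 1 0) μ))⁻¹ *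
            (∫ k', ((if withU then 1 else 0) + lindhardFunction (squareDispersion 1 0) μ (k + k')) * Φ k'
              ∂fermiCurveMeasure (squareDispersion 1 0) μ) - inner ℝ wV v * l * ψ k := by
      have h1 : A η = A (x : Lp ℝ 2 (fermiCurveMeasure (squareDispersion 1 0) μ)) - (inner ℝ wV v * l) • hψs.1.toLp ψ := by
        rw [hη, map_sub, map_smul, hAw, smul_smul]
      rw [h1]
      filter_upwards [Lp.coeFn_sub (A (x : Lp ℝ 2 (fermiCurveMeasure (squareDispersion 1 0) μ))) ((inner ℝ wV v * l) • hψs.1.toLp ψ),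
        Lp.coeFn_smul (inner ℝ wV v * l) (hψs.1.toLp ψ), hAx, hwae] with k hk1 hk2 hk3 hk4
      rw [hk1, Pi.sub_apply, hk2, Pi.smul_apply, hk3, hk4, smul_eq_mul]
    filter_upwards [hrem, hAη] with k hk hk'
    rw [hk'] at hk
    have h3 := (abs_sub_abs_le_abs_sub _ _).trans (hk.trans (mul_le_mul_of_nonneg_left hηnorm' (Real.sqrt_nonneg _)))
    have h4 : |inner ℝ wV v * l * ψ k| ≤ |min ((β * ρlo - ρlo ^ 2 - et) / (β - ρlo)) ((β * ρhi - ρhi ^ 2 - et) / (β - ρhi))| * |ψ k| := by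
      rw [abs_mul, abs_mul]
      exact mul_le_mul_of_nonneg_right (by nlinarith [abs_nonneg (inner ℝ wV v), abs_nonneg l]) (abs_nonneg _)
    rw [abs_mul, abs_of_pos (inv_pos.2 hsqrtN), ← div_eq_inv_mul, sub_le_iff_le_add, div_le_iff₀ hsqrtN] at h3
    nlinarith [h3, h4, Real.sqrt_nonneg R2, Real.sqrt_nonneg (et / (β - ρhi) ^ 2), hsqrtN.le, mul_le_mul_of_nonneg_right h4 hsqrtN.le]
  · -- `χ = E`: the eigenspace is the plane through `wV`, `U₁ wV`
    have hUV : ∀ y ∈ V, U₁ y ∈ V := by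
      intro y hy
      rw [hmemV] at hy ⊢
      have h1 := congrArg (fun f => f y) hPU
      simp only [mul_apply_eq_comp] at h1
      rw [hy] at h1
      exact h1
    have hAw₂ : A (U₁ (hψs.1.toLp ψ)) = l • U₁ (hψs.1.toLp ψ) := by
      change (A * U₁) (hψs.1.toLp ψ) = l • U₁ (hψs.1.toLp ψ)
      rw [hAU, mul_apply_eq_comp, hAw, map_smul]
    obtain ⟨w₂V, hw₂V⟩ : ∃ w₂V : V, (w₂V : Lp ℝ 2 (fermiCurveMeasure (squareDispersion 1 0) μ)) = U₁ (hψs.1.toLp ψ) :=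
      ⟨⟨_, hUV _ ((hmemV _).2 hwfix)⟩, rfl⟩
    have hTw₂V : T w₂V = l • w₂V := Subtype.ext (by rw [hT, Submodule.coe_smul, hw₂V]; exact hAw₂)
    have hw₂norm : ‖w₂V‖ = 1 := by
      have h0 : ‖(w₂V : Lp ℝ 2 (fermiCurveMeasure (squareDispersion 1 0) μ))‖ ^ 2 = ‖hψs.1.toLp ψ‖ ^ 2 := by
        rw [hw₂V, ← real_inner_self_eq_norm_sq, ← real_inner_self_eq_norm_sq, hUinner]
      rw [hwnorm] at h0
      have h1 : ‖(w₂V : Lp ℝ 2 (fermiCurveMeasure (squareDispersion 1 0) μ))‖ = 1 := by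
        nlinarith [norm_nonneg (w₂V : Lp ℝ 2 (fermiCurveMeasure (squareDispersion 1 0) μ))]
      exact h1
    have h12 : inner ℝ wV w₂V = 0 := by
      rw [Submodule.coe_inner, hwV, hw₂V]; exact hEskew hE _ hwfix
    have hno : ∀ f : Fin 3 → V, Orthonormal ℝ f → (∀ j, T (f j) = l • f j) → False := by
      intro f hf heigf
      have h1 := hmass 3 f hf heigf
      have h2 : h < 3 * ρhi ^ 2 := by simpa [hE] using hmul
      push_cast at h1
      linarith
    have hvspan : v = (inner ℝ wV v) • wV + (inner ℝ w₂V v) • w₂V := eq_add_smul_of_no_orthonormal_triple T l hwVnorm hw₂norm h12 hTwV hTw₂V hno hTv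
    have hvH : (v : Lp ℝ 2 (fermiCurveMeasure (squareDispersion 1 0) μ)) =
        (inner ℝ wV v) • hψs.1.toLp ψ + (inner ℝ w₂V v) • U₁ (hψs.1.toLp ψ) := by
      conv_lhs => rw [hvspan]
      rw [Submodule.coe_add, Submodule.coe_smul, Submodule.coe_smul, hwV, hw₂V]
    have hab : (inner ℝ wV v) ^ 2 + (inner ℝ w₂V v) ^ 2 ≤ 1 := by
      have hw2n : ‖U₁ (hψs.1.toLp ψ)‖ = 1 := by rw [← hw₂V]; exact hw₂norm
      have h12H : inner ℝ (hψs.1.toLp ψ) (U₁ (hψs.1.toLp ψ)) = 0 := hEskew hE _ hwfix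
      have h21H : inner ℝ (U₁ (hψs.1.toLp ψ)) (hψs.1.toLp ψ) = 0 := by rw [real_inner_comm]; exact h12H
      have h1 : ‖(v : Lp ℝ 2 (fermiCurveMeasure (squareDispersion 1 0) μ))‖ ^ 2 = (inner ℝ wV v) ^ 2 + (inner ℝ w₂V v) ^ 2 := by
        rw [hvH, ← real_inner_self_eq_norm_sq, inner_add_left, inner_add_right, inner_add_right, real_inner_smul_left,
          real_inner_smul_left, real_inner_smul_left, real_inner_smul_left, real_inner_smul_right, real_inner_smul_right,
          real_inner_smul_right, real_inner_smul_right, real_inner_self_eq_norm_sq, real_inner_self_eq_norm_sq, hwnorm, hw2n, h12H, h21H]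
        ring
      have h2 : ‖(v : Lp ℝ 2 (fermiCurveMeasure (squareDispersion 1 0) μ))‖ ≤ 1 := by rw [Submodule.norm_coe]; exact hvnorm
      nlinarith [norm_nonneg (v : Lp ℝ 2 (fermiCurveMeasure (squareDispersion 1 0) μ))]
    -- the remainder
    obtain ⟨η, hη⟩ : ∃ η : Lp ℝ 2 (fermiCurveMeasure (squareDispersion 1 0) μ), η = (x : Lp ℝ 2 (fermiCurveMeasure (squareDispersion 1 0) μ)) -
          ((inner ℝ wV v) • hψs.1.toLp ψ + (inner ℝ w₂V v) • U₁ (hψs.1.toLp ψ)) := ⟨_, rfl⟩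
    have hηeq : η = ((x - v : V) : Lp ℝ 2 (fermiCurveMeasure (squareDispersion 1 0) μ)) := by
      rw [hη, Submodule.coe_sub, hvH]
    have hηnorm' : ‖η‖ ≤ Real.sqrt (et / (β - ρhi) ^ 2) := by rw [hηeq, Submodule.norm_coe]; exact hηnorm
    have hrem := kl_nb_remainder_ae hμ _ hκ2 hA hR η
    have hrot : MeasurePreserving rotMomentum (fermiCurveMeasure (squareDispersion 1 0) μ)
        (fermiCurveMeasure (squareDispersion 1 0) μ) := stub_klD4Invariant stub_klGradient μ hμ (DihedralGroup.r 1)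
    have hw₂ae : (U₁ (hψs.1.toLp ψ) : Momentum → ℝ) =ᵐ[fermiCurveMeasure (squareDispersion 1 0) μ] fun k => ψ (rotMomentum k) := by
      filter_upwards [hU₁ae (hψs.1.toLp ψ), hrot.quasiMeasurePreserving.ae_eq hwae] with k hk hk'
      rw [hk]; exact hk'
    have hAη : (A η : Momentum → ℝ) =ᵐ[fermiCurveMeasure (squareDispersion 1 0) μ] fun k =>
        (Real.sqrt (∫ k, Φ k ^ 2 ∂fermiCurveMeasure (squareDispersion 1 0) μ))⁻¹ *
            (∫ k', ((if withU then 1 else 0) + lindhardFunction (squareDispersion 1 0) μ (k + k')) * Φ k'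
              ∂fermiCurveMeasure (squareDispersion 1 0) μ) -
          l * (inner ℝ wV v * ψ k + inner ℝ w₂V v * ψ (rotMomentum k)) := by
      have h1 : A η = A (x : Lp ℝ 2 (fermiCurveMeasure (squareDispersion 1 0) μ)) -
          ((l * inner ℝ wV v) • hψs.1.toLp ψ + (l * inner ℝ w₂V v) • U₁ (hψs.1.toLp ψ)) := by
        rw [hη, map_sub, map_add, map_smul, map_smul, hAw, hAw₂, smul_smul, smul_smul, mul_comm (inner ℝ wV v) l, mul_comm (inner ℝ w₂V v) l]
      rw [h1]
      filter_upwards [Lp.coeFn_sub (A (x : Lp ℝ 2 (fermiCurveMeasure (squareDispersion 1 0) μ)))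
          ((l * inner ℝ wV v) • hψs.1.toLp ψ + (l * inner ℝ w₂V v) • U₁ (hψs.1.toLp ψ)),
        Lp.coeFn_add ((l * inner ℝ wV v) • hψs.1.toLp ψ) ((l * inner ℝ w₂V v) • U₁ (hψs.1.toLp ψ)),
        Lp.coeFn_smul (l * inner ℝ wV v) (hψs.1.toLp ψ), Lp.coeFn_smul (l * inner ℝ w₂V v) (U₁ (hψs.1.toLp ψ)), hAx, hwae, hw₂ae]
        with k hk1 hk2 hk3 hk4 hk5 hk6 hk7
      rw [hk1, Pi.sub_apply, hk2, Pi.add_apply, hk3, hk4, Pi.smul_apply, Pi.smul_apply, hk5, hk6, hk7, smul_eq_mul, smul_eq_mul]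
      ring
    -- the pointwise statement at `k`
    have hpt : ∀ᵐ k ∂fermiCurveMeasure (squareDispersion 1 0) μ, |∫ k', ((if withU then 1 else 0) + lindhardFunction (squareDispersion 1 0) μ (k + k')) * Φ k'
            ∂fermiCurveMeasure (squareDispersion 1 0) μ| ≤
          Real.sqrt (∫ k, Φ k ^ 2 ∂fermiCurveMeasure (squareDispersion 1 0) μ) *
            (|min ((β * ρlo - ρlo ^ 2 - et) / (β - ρlo)) ((β * ρhi - ρhi ^ 2 - et) / (β - ρhi))| * Real.sqrt (ψ k ^ 2 + ψ (rotMomentum k) ^ 2) +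
              Real.sqrt R2 * Real.sqrt (et / (β - ρhi) ^ 2)) := by
      filter_upwards [hrem, hAη] with k hk hk'
      rw [hk'] at hk
      have h3 := (abs_sub_abs_le_abs_sub _ _).trans (hk.trans (mul_le_mul_of_nonneg_left hηnorm' (Real.sqrt_nonneg _)))
      have h4 : |l * (inner ℝ wV v * ψ k + inner ℝ w₂V v * ψ (rotMomentum k))| ≤
          |min ((β * ρlo - ρlo ^ 2 - et) / (β - ρlo)) ((β * ρhi - ρhi ^ 2 - et) / (β - ρhi))| * Real.sqrt (ψ k ^ 2 + ψ (rotMomentum k) ^ 2) := by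
        rw [abs_mul]
        exact mul_le_mul hlL (kl_nb_cs_two hab) (abs_nonneg _) (abs_nonneg _)
      rw [abs_mul, abs_of_pos (inv_pos.2 hsqrtN), ← div_eq_inv_mul, sub_le_iff_le_add, div_le_iff₀ hsqrtN] at h3
      nlinarith [h3, h4, Real.sqrt_nonneg R2, Real.sqrt_nonneg (et / (β - ρhi) ^ 2), hsqrtN.le, mul_le_mul_of_nonneg_right h4 hsqrtN.le]
    -- and transported by `rot³`
    have hrot3 : MeasurePreserving (fun k => rotMomentum (rotMomentum (rotMomentum k)))
        (fermiCurveMeasure (squareDispersion 1 0) μ) (fermiCurveMeasure (squareDispersion 1 0) μ) :=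
      stub_klD4Invariant stub_klGradient μ hμ (DihedralGroup.r 3)
    have hodd : ∀ k, ψ (-k) = -ψ k := (inChannel_E_iff_odd ψ).1 (hE ▸ hψs.2.2)
    filter_upwards [hpt, hrot3.quasiMeasurePreserving.ae hpt] with k hk hk3
    refine ⟨hk, ?_⟩
    have h1 : ψ (rotMomentum (rotMomentum (rotMomentum k))) ^ 2 + ψ (rotMomentum (rotMomentum (rotMomentum (rotMomentum k)))) ^ 2 =
        ψ k ^ 2 + ψ (rotMomentum k) ^ 2 := by
      rw [kl_d4_rot_rot_rot_rot, CwKLChiralWindow.Negative.rot_rot (rotMomentum k), hodd]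
      ring
    rw [h1] at hk3
    exact hk3

end Summit.HubbardSuperconductivity.HubbardSuperconductivity.Theorems

end
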